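import Summits.HodgeConjecture.HodgeConjecture.Cruxes.BlochSeedDiscOne.SeedChecker
import Summits.HodgeConjecture.HodgeConjecture.Theorems.HeckePrymWeilHyperbolicEightfoldsSqrtMinus7HypProd
import Summits.HodgeConjecture.HodgeConjecture.Theorems.Ring2AbelianAllWeilCellsInhabited

/-!
# `Cruxes/BlochSeedDiscOne/SeedCheckerKit.lean` — SEED CHECKER v6, satellite §9 of `SeedChecker.lean` (crux
# `EightfoldBlochSeeds.BlochSeedDiscOne`, item stmt-HodgeConjecture-18881): THE ANCHOR KIT EXISTS — all three kit obligations
# of v4 (O-hyp, O-pol, O-W-existence) DISCHARGED as theorems on every CM anchor (design-independent); the stub's non-seed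
# conjuncts jointly met; the lci door's law made ANCHOR-LOCAL; the two door budgets as checked constants

HONEST FRAMING. Typed by planner seat `hsemireg-c5c8-1` (g5; director-hodge g20 MINT block A5 «C5–C8 as predicates on (design json,
presentation); flag the vacuous ∕ implied ones; state nothing proved») for the computation cell `pub-hsemireg`. Line of record:
`Cruxes/BlochSeedDiscOne/Lines/birth.lean` 814a6a70c14e831a, stub `stub_rung_pad4_seedAt`. This satellite imports `SeedChecker.lean` v4
(13437bb9848c3c36) UNCHANGED and sits BESIDE `SeedCheckerPorteous.lean` v5 (0e6fc41a4915935f) in the same namespace (no name of v4 ∕ v5 is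
restated or shadowed; v5 is not imported, so the two satellites can be read in either order). NOTHING here is proved toward HC ∕ HC_CM ∕
HC_AV ∕ №4 ∕ 26512 ∕ 18881 ∕ H2: no design is realised, no bundle ∕ section ∕ subscheme is exhibited, the stub stays open. What IS proved is
kit-level and design-independent (§9.1–§9.1d): the three anchor-kit obligations of v4 — `AnchorKit.hyperbolic` «O-hyp», `AnchorKit.pol`
«O-pol», `AnchorKit.F` «O-W» (existence of SOME rational frame) — are theorems, so `AnchorKit E₀ ψ₀` is INHABITED on every CM anchor
(`anchorKit_nonempty`): the checker's anchor side is NOT VACUOUS, and every conjunct of `stub_rung_pad4_seedAt` except the last,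
`HasBlochSeedAt`, holds with the checker's own `h_K = 2t·h_std` (`stub_conjuncts_without_seed`) — which isolates, and does not touch,
the stub's open content (the seed).

§9.1 O-hyp DISCHARGED (pad4-tower compatibility with the stub's binder `IsHyperbolicWeilType (pad4Anchor E₀) (pad4Action E₀ ψ₀) 4 (symH …)`).
For EVERY CM datum `(E₀, ψ₀)`, `dim E₀ = 1`, `ψ₀ ≫ ψ₀ = -1`, and EVERY rational `η ∈ H²(E₀(ℂ); ℂ)`: `hSurf_hyperbolic` — the Weil surface
`(S, φ_S) = (E₀ × E₀, ψ₀ × (−ψ₀))` is of hyperbolic Weil type in half-dimension `1` for `h_S = pr₁^*η + pr₂^*η` (van Geemen 5.3 with equal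
weights: the isotropic `K`-line `{(v, v), (ψ₀^*v, −ψ₀^*v)}`; the tree's `cmCurve_rationalModel` + `cmSquare_equalWeight_blockVectors` fed to
`isHyperbolicWeilType_prod_of_rationalModels` — the SAME computation the tree runs inside `aimedSplitProduct_cmSquare_of_dim_eq_zero`, but
for the frame's own class `h_S`, not for an opaque Segre class); `hPad2_hyperbolic`, `hPad3_hyperbolic`, **`hStd_hyperbolic :
HStdHyperbolic E₀ ψ₀ η`** — three applications of «hyperbolic × hyperbolic is hyperbolic» (the landed
`Theorems/HeckePrymWeilHyperbolicEightfoldsSqrtMinus7HypProd.isHyperbolicWeilType_prod_of_isHyperbolicWeilType`, whose product shape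
`prodLift (fst ≫ ·) (snd ≫ φ_S)`, `pr₁^*h + pr₂^*h_S` is LITERALLY that of `pad4Action` ∕ `hStd`); `isHyperbolicWeilType_symH_of_pullback_eq`
(the stub's binder for any `(e, a)` with `e^*a = t·h_std`, `t ≠ 0`); **`AnchorKit.ofFramePol`** — the anchor kit from `η`, a Weil frame (O-W) and a
polarisation datum (O-pol) ALONE. Consequence for the checker: every v4 ∕ v5 door theorem that reads an `AnchorKit` now costs O-W + O-pol only.
§9.1b O-pol DISCHARGED: `exists_polarisation` — a rational `η = f₀^*g_M ≠ 0` (`f₀ : E₀ ↪ ℙᴹ`; `η ≠ 0` by van Geemen Lemma 5.2 (1)–(2):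
a vanishing hyperplane class would have a degenerate discriminant, `exists_hasWeilDiscriminantNondeg` ∕ `not_hasWeilDiscriminantNondeg_zero`)
and a `Polarisation E₀ η` with `t = 1`: `S = E₀ × E₀` embedded by `f₀ ⊗ f₀ ≫ σ` has class `h_S` (the tree's `exists_projectiveEmbedding_cmSquare`,
EQUAL weights `m₁ = m₂ = 1`), and three Segre products (`exists_projectiveEmbedding_prod`, Hartshorne II Ex. 5.11–5.12) give `S⁴ ↪ ℙ` with class
`h_std` on the nose. §9.1c O-W DISCHARGED AS EXISTENCE: `weilFrame_nonempty` — the Weil plane of `(S⁴, ψ)` is `2`-dimensional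
(`finrank_weilClassesOf_eq_two`) and the complex span of its rational classes (`weilClassesOf_eq_span_isRationalClass`, van Geemen 4.9), so it
contains two rational `ℂ`-independent classes (`exists_pair_indep_of_eq_span`, linear algebra). FLAG (honest): the frame so obtained is SOME
rational frame (opaque, by choice), NOT the cell's normalised `r₁ = eeee + ēēēē`, `r₂ = i(eeee − ēēēē)` which v4 §3's dictionary «`wOf μ` ↔ the
design's `μ`» presumes — that NORMALISATION (call it O-W♮: an `H¹`-level frame `e, ē` and `eeee = e₁e₂e₃e₄…`) is untouched and is what a
concrete (σ)-check of a realised design still needs; every frame gives `wOf μ ≠ 0 ⟺ μ ≠ 0`, which is all the lci door's (σ) reads.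
§9.1d `anchorKit_nonempty : Nonempty (AnchorKit E₀ ψ₀)` on every CM anchor; `stub_conjuncts_without_seed`; `blochSeedDiscOne_of_seedChecks'`
(v4's door with the anchor side paid: the hypothesis may assume a kit).
§9.1e `polarisation_nonempty` — O-pol for EVERY rational `η ≠ 0` (so the checker may be run against the cell's own generator `η₀`:
`H²(E₀(ℂ); ℂ)` is a line, `exists_eq_ratCast_smul_of_curve`, sign fixed by `a ↦ −a`); `anchorKit_nonempty_of_frame` (a kit with
prescribed `η` and frame); and **`blochSeedDiscOne_of_lciSeeds` — THE LCI DOOR WITH THE WHOLE ANCHOR SIDE PAID**: the crux follows from,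
on every CM anchor and for some rational `η ≠ 0`, an lci seed `i : Z ↪ S⁴` (closed regular immersion of codimension `4`, `Z` integral,
points of codimension `≥ 4`, Bloch-semiregular in the `8`-fold) with `c·h_std(η)⁴ + w` supported on `Z` for a rational `c` and ANY
rational non-zero Weil class `w` — no kit, no frame, no `μ`, no polarisation, no hyperbolicity hypothesis (all supplied by §9.1–9.1d;
`q = c ∕ (2t)⁴`). Hypothesis-carrying, concludes the crux BY NAME; what it leaves is EXACTLY the seed.
§9.2 LAW HYGIENE (lci door): `TopChernFourLocalisationOn C X` — v4's top-Chern-class localisation law RESTRICTED TO ONE CARRIER `X` (the doors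
only ever instantiate it at `X = S⁴`; the global `TopChernFourLocalisation C` quantifies over every `SchemeOver ℂ`, pathological ones included,
and implies the local form: `TopChernFourLocalisation.on`); the zero-scheme door re-derived from the local law with otherwise IDENTICAL
hypotheses: `supported_of_zeroScheme_on`, `supported_symH_of_zeroScheme_on`, `Design.seedCheck_of_zeroScheme_on`, `blochSeedDiscOne_of_zeroSchemes_on`
(hypothesis-carrying, concludes the crux BY NAME). Still a NAMED LAW (a `Prop` consumed as a hypothesis, neither proved nor asserted).
§9.3 JSON: THE TWO DOOR BUDGETS as kernel-checked constants — `hodgeNumberOfPower g a b = C(g,a)·C(g,b)` (`= h^{a,b}(E₀^g)`, Birkenhake–Lange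
Cor. 1.4.? ∕ Künneth; the identification with `dim H^b(S⁴, Ωᵃ)` is PENCIL — the tree's `hodgeCohomology` carries no dimension), the SHEAF door's
(σ)-target `sheafDoorBudget {0,1,2,3} = 28 + 448 + 1960 + 3136 = 5572` (the cell's door count of record, C4-EXT2-COUNT-c4-1-g5 §12: a necessary
condition for injectivity of `σ = ⊕_{q ≤ 3} σ_q` on `Ext²(𝓔, 𝓔)` is `dim Ext² ≤ 5572`) and the LCI door's target `lciDoorBudget = h^{3,5} = 3136`
(Bloch's `π : H¹(Z, 𝒩) → H⁵(S⁴, Ω³)` injective needs `h¹(𝒩_{Z∕S⁴}) ≤ 3136`). MECH (`decide`); they screen nothing by themselves.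

v6 FLAGS. §9.1–§9.1d are THEOREMS about the anchor (MATH, proved, design-independent; axioms of `stub_conjuncts_without_seed`: propext,
Classical.choice, Quot.sound): they neither realise a design nor touch C5–C8 of a candidate, and `stub_conjuncts_without_seed` is NOT a rung —
the analogous datum with the tree's WEIGHTED Segre class was already in reach (`aimedSplitProduct_cmSquare_of_pos`); new is that the checker's
EQUAL-weight class `h_std` (the one the C0–C8 dictionary is written in) carries it. §9.2 is MECH (the same door under a weaker hypothesis);
§9.3 is JSON-side arithmetic. The C0–C8 dictionary, the doors, their flags and the
«nothing proved toward the summit» clause are those of v4's module docstring and v5's §8 header, unchanged.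
-/

noncomputable section

set_option linter.dupNamespace false

open CategoryTheory AlgebraicGeometry
open Literature.AlgebraicGeometry Literature.AlgebraicGeometry.Motives Literature.AlgebraicGeometry.HodgeTheory
open Literature.AlgebraicTopology.SingularHomology

namespace Summit.HodgeConjecture.HodgeConjecture.Cruxes.BlochSeedDiscOne.SeedChecker

open Summit.HodgeConjecture.HodgeConjecture.Cruxes.BlochSeedDiscOne.Anchor
open Summit.Ventures.HSemireg Summit.Ventures.HSemireg.Pad4Tower
open Summit.HodgeConjecture.HodgeConjecture.Theorems.HyperbolicEightfoldsSqrtMinus7.HyperbolicReach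
open Summit.HodgeConjecture.HodgeConjecture.Ring2.AbelianAll (exists_projectiveEmbedding_prod exists_projectiveEmbedding_cmSquare)
open Literature.AlgebraicGeometry.VanGeemen1994 (exists_hasWeilDiscriminantNondeg not_hasWeilDiscriminantNondeg_zero)

section VSix

/-! ## §9.1 O-hyp DISCHARGED: `h_std` is of hyperbolic Weil type on every CM anchor; the kit from a frame + a polarisation -/

section OHyp

variable {E₀ : AbelianVariety ℂ} {ψ₀ : E₀ ⟶ E₀} {η : complexBetti E₀.X 2}

/-- `dim S² = 2·2`. -/
theorem pad2Anchor_dim (hE : E₀.dim = 1) : (pad2Anchor E₀).dim = 2 * 2 := by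
  have h2 : (pad2Anchor E₀).dim = 2 * (1 + 1) := dim_prod_eq_two_mul (weilSurf_dim hE) (weilSurf_dim hE)
  simpa using h2

/-- `dim S³ = 2·3`. -/
theorem pad3Anchor_dim (hE : E₀.dim = 1) : (pad3Anchor E₀).dim = 2 * 3 := by
  have h3 : (pad3Anchor E₀).dim = 2 * (2 + 1) := dim_prod_eq_two_mul (pad2Anchor_dim hE) (weilSurf_dim hE)
  simpa using h3

/-- **THE WEIL SURFACE IS HYPERBOLIC FOR `h_S = pr₁^*η + pr₂^*η`** (van Geemen, LNM 1594, Lemma 5.3 with equal weights `m₁ = m₂`: on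
`(E₀ × E₀, ψ₀ × (−ψ₀))` the `K`-line `{(v, v), (ψ₀^*v, −ψ₀^*v)}` of `H¹` is rational, `φ_S^*`-stable and isotropic for `Q_{h_S} = h_S ∪ · ∪ ·`),
for EVERY rational `η` (for `η = 0` the pairing vanishes identically). Proof: the CM curve's rational degree-one model `(v, ψ₀^*v)`
(`cmCurve_rationalModel`: matrices `M_E = ((0,−1),(1,0))` of `ψ₀^*`, `−M_E` of `(−ψ₀)^*`, Gram matrix `G_E = ((0,1),(−1,0))`, `η = t·ω`), the
equal-weight block vectors `(e₀, e₀), (e₁, −e₁)` (`cmSquare_equalWeight_blockVectors 1 t`), and the product-of-rational-models criterion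
`isHyperbolicWeilType_prod_of_rationalModels` for `E₀ × E₀` with BOTH weights `t`. Design-independent; (pad4)(iii) at the surface level.
[cite: vanGeemen1994HodgeAV, Lemma 5.2 (2)–(3), 5.3 and 5.4 (5.4.1)] -/
theorem hSurf_hyperbolic (hE : E₀.dim = 1) (hψ : ψ₀ ≫ ψ₀ = -(1 • 𝟙 E₀)) (hη : IsRationalClass η) :
    IsHyperbolicWeilType (weilSurf E₀) (weilSurfAct E₀ ψ₀) 1 (hSurf E₀ η) := by
  classical
  obtain ⟨u, ω, hur, hui, -, hM, hMneg, -, -, hG, htop, -, -⟩ := cmCurve_rationalModel hE one_pos hψ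
  obtain ⟨t, ht⟩ := htop η hη
  obtain ⟨b, hb, hbM, hbG⟩ := cmSquare_equalWeight_blockVectors ((1 : ℕ) : ℚ) t
  have hE' : E₀.dim = 0 + 1 := hE
  exact isHyperbolicWeilType_prod_of_rationalModels (φ := ψ₀) (ψ := -ψ₀) hE' hE' (by norm_num) u hur hui _ hM
    u hur hui _ hMneg η ω _ (hG η) t ht η ω _ (hG η) t ht b hb hbM hbG

/-- **`S² = S × S` is hyperbolic for `h = pr₁^*h_S + pr₂^*h_S` in half-dimension `2`** (hyperbolic × hyperbolic is hyperbolic: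
`isHyperbolicWeilType_prod_of_isHyperbolicWeilType`, whose product shape is literally `pad2Action` ∕ `hPad2`).
[cite: vanGeemen1994HodgeAV, Lemma 5.2 (2)–(3) and 5.4] -/
theorem hPad2_hyperbolic (hE : E₀.dim = 1) (hψ : ψ₀ ≫ ψ₀ = -(1 • 𝟙 E₀)) (hη : IsRationalClass η) :
    IsHyperbolicWeilType (pad2Anchor E₀) (pad2Action E₀ ψ₀) 2 (hPad2 E₀ η) :=
  isHyperbolicWeilType_prod_of_isHyperbolicWeilType one_pos one_pos (weilSurf_dim hE) (weilSurf_dim hE)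
    (hSurf_hyperbolic hE hψ hη) (hSurf_hyperbolic hE hψ hη)

/-- **`S³ = S² × S` is hyperbolic for `hPad3` in half-dimension `3`.** [cite: vanGeemen1994HodgeAV, Lemma 5.2 (2)–(3) and 5.4] -/
theorem hPad3_hyperbolic (hE : E₀.dim = 1) (hψ : ψ₀ ≫ ψ₀ = -(1 • 𝟙 E₀)) (hη : IsRationalClass η) :
    IsHyperbolicWeilType (pad3Anchor E₀) (pad3Action E₀ ψ₀) 3 (hPad3 E₀ η) :=
  isHyperbolicWeilType_prod_of_isHyperbolicWeilType two_pos one_pos (pad2Anchor_dim hE) (weilSurf_dim hE)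
    (hPad2_hyperbolic hE hψ hη) (hSurf_hyperbolic hE hψ hη)

/-- **O-hyp DISCHARGED: the pad-4 anchor `(S⁴, ψ)` is of hyperbolic Weil type in half-dimension `4` for the frame's class `h_std`**,
for every CM datum `(E₀, ψ₀)` (`dim E₀ = 1`, `ψ₀² = −1`) and every rational `η` — v4's `HStdHyperbolic E₀ ψ₀ η`, the field
`AnchorKit.hyperbolic` ((pad4)(iii)), is a THEOREM: `S⁴ = S³ × S`, hyperbolic × hyperbolic. Design-independent; it realises no design and
touches no C5–C8 of a candidate. [cite: vanGeemen1994HodgeAV, Lemma 5.2 (2)–(3), 5.3 and 5.4 (5.4.1)] [cite: Markman2025SurveySecant, §11.5 Step 2] -/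
theorem hStd_hyperbolic (hE : E₀.dim = 1) (hψ : ψ₀ ≫ ψ₀ = -(1 • 𝟙 E₀)) (hη : IsRationalClass η) :
    HStdHyperbolic E₀ ψ₀ η :=
  isHyperbolicWeilType_prod_of_isHyperbolicWeilType three_pos one_pos (pad3Anchor_dim hE) (weilSurf_dim hE)
    (hPad3_hyperbolic hE hψ hη) (hSurf_hyperbolic hE hψ hη)

/-- **the stub's hyperbolicity binder for any polarisation datum**: if `e^*a = t·h_std` with `t ≠ 0` (rational `η`), then
`(S⁴, ψ, symH ψ e a = 2t·h_std)` is of hyperbolic Weil type in half-dimension `4` (`isHyperbolicWeilType_symH_iff` + `hStd_hyperbolic`). -/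
theorem isHyperbolicWeilType_symH_of_pullback_eq (hE : E₀.dim = 1) (hψ : ψ₀ ≫ ψ₀ = -(1 • 𝟙 E₀)) (hη : IsRationalClass η)
    (e : ProjectiveEmbedding (pad4Anchor E₀).X) (a : complexBetti (projectiveSpace e.n ℂ) 2) {t : ℚ} (ht : t ≠ 0)
    (hpull : complexBetti.map e.ι 2 a = ((t : ℚ) : ℂ) • hStd E₀ η) :
    IsHyperbolicWeilType (pad4Anchor E₀) (pad4Action E₀ ψ₀) 4 (symH (pad4Action E₀ ψ₀) e a) :=
  (isHyperbolicWeilType_symH_iff hE hψ e a ht hpull).2 (hStd_hyperbolic hE hψ hη)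

/-- **THE ANCHOR KIT FROM O-W AND O-pol ALONE**: the rational generator `η ≠ 0`, a Weil frame `F` (O-W) and a polarisation datum `pol`
(O-pol) give v4's `AnchorKit E₀ ψ₀` — the field `hyperbolic` (O-hyp) is supplied by `hStd_hyperbolic`. Every v4 ∕ v5 door theorem reading a
kit (`Design.seedCheck_of_…`, `seedData_of_seedCheck`, `blochSeedDiscOne_of_…`) therefore costs O-W + O-pol on the anchor side. -/
def AnchorKit.ofFramePol (hE : E₀.dim = 1) (hψ : ψ₀ ≫ ψ₀ = -(1 • 𝟙 E₀)) (hη : IsRationalClass η) (hη0 : η ≠ 0)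
    (F : WeilFrame E₀ ψ₀) (pol : Polarisation E₀ η) : AnchorKit E₀ ψ₀ where
  η := η
  η_rational := hη
  η_ne_zero := hη0
  F := F
  pol := pol
  hyperbolic := hStd_hyperbolic hE hψ hη

@[simp] theorem AnchorKit.ofFramePol_η (hE : E₀.dim = 1) (hψ : ψ₀ ≫ ψ₀ = -(1 • 𝟙 E₀)) (hη : IsRationalClass η) (hη0 : η ≠ 0)
    (F : WeilFrame E₀ ψ₀) (pol : Polarisation E₀ η) : (AnchorKit.ofFramePol hE hψ hη hη0 F pol).η = η := rfl

@[simp] theorem AnchorKit.ofFramePol_F (hE : E₀.dim = 1) (hψ : ψ₀ ≫ ψ₀ = -(1 • 𝟙 E₀)) (hη : IsRationalClass η) (hη0 : η ≠ 0)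
    (F : WeilFrame E₀ ψ₀) (pol : Polarisation E₀ η) : (AnchorKit.ofFramePol hE hψ hη hη0 F pol).F = F := rfl

@[simp] theorem AnchorKit.ofFramePol_pol (hE : E₀.dim = 1) (hψ : ψ₀ ≫ ψ₀ = -(1 • 𝟙 E₀)) (hη : IsRationalClass η) (hη0 : η ≠ 0)
    (F : WeilFrame E₀ ψ₀) (pol : Polarisation E₀ η) : (AnchorKit.ofFramePol hE hψ hη hη0 F pol).pol = pol := rfl

/-- **the lci seed checker needs O-W + O-pol only on the anchor side**: a design check against the kit `ofFramePol` unpacks into the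
stub's conclusion on that anchor (v4's `seedData_of_seedCheck`, restated with the kit assembled here; hypothesis-carrying). -/
theorem seedData_of_seedCheck_ofFramePol (hE : E₀.dim = 1) (hψ : ψ₀ ≫ ψ₀ = -(1 • 𝟙 E₀)) (hη : IsRationalClass η) (hη0 : η ≠ 0)
    (F : WeilFrame E₀ ψ₀) (pol : Polarisation E₀ η) {D : Design} {Z : Scheme.{0}} {i : Z ⟶ (pad4Anchor E₀).X.left} {q : ℚ}
    (h : D.SeedCheck (AnchorKit.ofFramePol hE hψ hη hη0 F pol) i q) :
    ∃ (e : ProjectiveEmbedding (pad4Anchor E₀).X) (a : complexBetti (projectiveSpace e.n ℂ) 2)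
      (w : complexBetti (pad4Anchor E₀).X (2 * 4)),
      IsRationalClass a ∧ a ≠ 0 ∧ IsHyperbolicWeilType (pad4Anchor E₀) (pad4Action E₀ ψ₀) 4 (symH (pad4Action E₀ ψ₀) e a) ∧
        w ∈ weilClassesOf (pad4Anchor E₀) (pad4Action E₀ ψ₀) 4 1 ∧ IsRationalClass w ∧ w ≠ 0 ∧
        HasBlochSeedAt 4 (pad4Anchor E₀) (symH (pad4Action E₀ ψ₀) e a) w :=
  seedData_of_seedCheck hE hψ h

end OHyp

/-! ## §9.1b O-pol DISCHARGED: an equal-weight Segre embedding of `S⁴` with hyperplane class `h_std` (`t = 1`) -/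

section OPol

variable {E₀ : AbelianVariety ℂ} {ψ₀ : E₀ ⟶ E₀}

/-- **O-pol DISCHARGED (equal-weight Segre).** For every CM datum `(E₀, ψ₀)` there are a rational generator-type class
`η = f₀^*g_M ≠ 0` of `H²(E₀(ℂ); ℂ)` (`f₀ : E₀ ↪ ℙᴹ` a closed immersion, `g` the tree's Segre-additive rational hyperplane family
`exists_segreHyperplaneClasses`) and a polarisation datum `Polarisation E₀ η` with `t = 1`: the embedding of `S = E₀ × E₀` by
`f₀ ⊗ f₀ ≫ σ` has hyperplane class `pr₁^*η + pr₂^*η = h_S` (the tree's `exists_projectiveEmbedding_cmSquare` with weights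
`m₁ = m₂ = 1`), and three further Segre products (`exists_projectiveEmbedding_prod`) give `S²`, `S³`, `S⁴` with classes `hPad2`,
`hPad3`, `h_std` ON THE NOSE. `η ≠ 0` is van Geemen's Lemma 5.2 (1)–(2) (a zero hyperplane class would have a degenerate
discriminant: `exists_hasWeilDiscriminantNondeg` ∕ `not_hasWeilDiscriminantNondeg_zero`, exactly as in the tree's `Ring2.AbelianAll.exists_member_one`).
[cite: Hartshorne1977, II Ex. 5.11 and Ex. 5.12] [cite: vanGeemen1994HodgeAV, Lemma 5.2 (1)–(2) and 5.3] -/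
theorem exists_polarisation (hE : E₀.dim = 1) (hψ : ψ₀ ≫ ψ₀ = -(1 • 𝟙 E₀)) :
    ∃ η : complexBetti E₀.X 2, IsRationalClass η ∧ η ≠ 0 ∧ ∃ pol : Polarisation E₀ η, pol.t = 1 := by
  classical
  obtain ⟨g, hgr, hgnz, hgσ⟩ := exists_segreHyperplaneClasses
  obtain ⟨M, f₀, eS, hM, hen, hecl⟩ := exists_projectiveEmbedding_cmSquare g hgσ E₀ one_pos one_pos
  set η : complexBetti E₀.X 2 := complexBetti.map f₀ 2 (g M) with hηdef
  have hηr : IsRationalClass η := isRationalClass_complexBetti_map f₀ (hgr M)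
  -- `η ≠ 0`: else the hyperplane class of `S ↪ ℙ` vanishes and its discriminant degenerates (Lemma 5.2 (1)–(2))
  have hη0 : η ≠ 0 := by
    intro h0'
    obtain ⟨δ, hδ⟩ := exists_hasWeilDiscriminantNondeg one_pos (weilSurf_dim hE) one_pos (weilSurfAct_comp_self hψ) eS
      (hgr _) (hgnz _ hen)
    have hcl : complexBetti.map eS.ι 2 (g eS.n) = 0 := by
      rw [hecl, h0', smul_zero, map_zero, map_zero, add_zero]
    rw [hcl, map_zero, smul_zero, add_zero] at hδ
    exact not_hasWeilDiscriminantNondeg_zero one_pos δ hδ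
  -- `S ↪ ℙ` with class `h_S = pr₁^*η + pr₂^*η`
  have heS : complexBetti.map eS.ι 2 (g eS.n) = hSurf E₀ η := by
    rw [hecl, Nat.cast_one, one_smul]; rfl
  -- `S² ↪ ℙ`, `S³ ↪ ℙ`, `S⁴ ↪ ℙ` by Segre, classes `hPad2`, `hPad3`, `h_std`
  obtain ⟨e2, -, he2⟩ := exists_projectiveEmbedding_prod g hgσ eS eS
  have he2' : complexBetti.map e2.ι 2 (g e2.n) = hPad2 E₀ η := by rw [he2, heS]; rfl
  obtain ⟨e3, -, he3⟩ := exists_projectiveEmbedding_prod g hgσ e2 eS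
  have he3' : complexBetti.map e3.ι 2 (g e3.n) = hPad3 E₀ η := by rw [he3, he2', heS]; rfl
  obtain ⟨e4, hn4, he4⟩ := exists_projectiveEmbedding_prod g hgσ e3 eS
  have he4' : complexBetti.map e4.ι 2 (g e4.n) = hStd E₀ η := by rw [he4, he3', heS]; rfl
  exact ⟨η, hηr, hη0, ⟨e4, g e4.n, 1, hgr _, hgnz _ (hen.trans hn4), one_pos, by rw [he4', Rat.cast_one, one_smul]⟩, rfl⟩

end OPol

/-! ## §9.1c O-W DISCHARGED (existence): the Weil plane of `(S⁴, ψ)` is a rational plane, so a rational frame exists -/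

section OW

/-- MECH (linear algebra): a `2`-dimensional subspace spanned by a set `R` contains two members of `R` that are linearly
independent (first a non-zero member, then a member off its line). -/
theorem exists_pair_indep_of_eq_span {K V : Type*} [Field K] [AddCommGroup V] [Module K V] {W : Submodule K V}
    {R : Set V} (hW : W = Submodule.span K R) (h2 : Module.finrank K W = 2) :
    ∃ c₁ ∈ R, ∃ c₂ ∈ R, ∀ s t : K, s • c₁ + t • c₂ = 0 → s = 0 ∧ t = 0 := by
  classical
  obtain ⟨c₁, hc₁R, hc₁0⟩ : ∃ c₁ ∈ R, c₁ ≠ 0 := by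
    by_contra! hall
    have hbot : W = ⊥ := by rw [hW, Submodule.span_eq_bot]; exact hall
    rw [hbot, finrank_bot] at h2
    exact absurd h2 (by norm_num)
  haveI : Module.Finite K (Submodule.span K ({c₁} : Set V)) :=
    Module.finite_of_finrank_eq_succ (finrank_span_singleton hc₁0)
  obtain ⟨c₂, hc₂R, hc₂⟩ : ∃ c₂ ∈ R, c₂ ∉ Submodule.span K ({c₁} : Set V) := by
    by_contra! hall
    have hle : W ≤ Submodule.span K ({c₁} : Set V) := by rw [hW, Submodule.span_le]; exact hall
    have h1 := Submodule.finrank_mono hle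
    rw [h2, finrank_span_singleton hc₁0] at h1
    exact absurd h1 (by norm_num)
  refine ⟨c₁, hc₁R, c₂, hc₂R, fun s t hst => ?_⟩
  by_cases ht : t = 0
  · subst ht
    rw [zero_smul, add_zero] at hst
    exact ⟨(smul_eq_zero.1 hst).resolve_right hc₁0, rfl⟩
  · exfalso
    apply hc₂
    have htc : t • c₂ = -(s • c₁) := eq_neg_of_add_eq_zero_right hst
    have hc₂eq : c₂ = (-(t⁻¹ * s)) • c₁ := by
      calc c₂ = t⁻¹ • (t • c₂) := by rw [smul_smul, inv_mul_cancel₀ ht, one_smul]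
        _ = (-(t⁻¹ * s)) • c₁ := by rw [htc, smul_neg, smul_smul, neg_smul]
    rw [hc₂eq]
    exact Submodule.smul_mem _ _ (Submodule.mem_span_singleton_self c₁)

variable {E₀ : AbelianVariety ℂ} {ψ₀ : E₀ ⟶ E₀}

/-- **O-W DISCHARGED (existence of a rational Weil frame).** For every CM datum `(E₀, ψ₀)` the Weil plane
`weilClassesOf (pad4Anchor E₀) (pad4Action E₀ ψ₀) 4 1 ⊂ H⁸(S⁴(ℂ); ℂ)` contains two RATIONAL, `ℂ`-independent classes, i.e.
v4's interface `WeilFrame E₀ ψ₀` is inhabited: the plane is `2`-dimensional (`finrank_weilClassesOf_eq_two`, from the tree's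
`⋀•H¹` structure of `H•(S⁴(ℂ))`) and is the complex span of its rational classes (`weilClassesOf_eq_span_isRationalClass`, van
Geemen 4.9 — the kernel of a rational operator), then `exists_pair_indep_of_eq_span`. HONEST FLAG: the frame so obtained is SOME
rational frame (chosen, opaque) — NOT the cell's normalised frame `r₁ = eeee + ēēēē`, `r₂ = i(eeee − ēēēē)`; the dictionary
«`wOf μ` = the design's `μ`» of v4 §3 presumes the normalised one (obligation O-W♮, untouched here); what every frame gives
is `wOf μ ≠ 0 ⟺ μ ≠ 0` (v4 `WeilFrame.wOf_ne_zero`), which is all (σ) reads.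
[cite: vanGeemen1994HodgeAV, 4.9 (PDF p. 218) and 4.10–4.11] -/
theorem weilFrame_nonempty (hE : E₀.dim = 1) (hψ : ψ₀ ≫ ψ₀ = -(1 • 𝟙 E₀)) : Nonempty (WeilFrame E₀ ψ₀) := by
  have hA : (pad4Anchor E₀).dim = 2 * 4 := pad4Anchor_dim hE
  have hφ := pad4Action_comp_self (E₀ := E₀) hψ
  have hΛ := Motives.AbelianVariety.hasExteriorCohomologyH1_complexPoints (pad4Anchor E₀)
  have hb₁ : Module.finrank ℂ (complexBetti (pad4Anchor E₀).X 1) = 2 * (2 * 4) := by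
    rw [Motives.AbelianVariety.finrank_complexBetti_one, hA]
  have h2 := finrank_weilClassesOf_eq_two hΛ hb₁ (by norm_num) one_pos hφ
  obtain ⟨c₁, ⟨hc₁r, hc₁w⟩, c₂, ⟨hc₂r, hc₂w⟩, hind⟩ :=
    exists_pair_indep_of_eq_span (weilClassesOf_eq_span_isRationalClass (by norm_num) hA one_pos hφ) h2
  exact ⟨⟨c₁, c₂, hc₁r, hc₂r, hc₁w, hc₂w, hind⟩⟩

end OW

/-! ## §9.1d THE ANCHOR KIT EXISTS on every CM anchor; the stub's non-seed conjuncts are jointly met -/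

section KitExists

variable {E₀ : AbelianVariety ℂ} {ψ₀ : E₀ ⟶ E₀}

/-- **THE ANCHOR SIDE OF THE CHECKER IS INHABITED (not vacuous): every CM anchor `(E₀, ψ₀)` carries an `AnchorKit`**
(O-W by `weilFrame_nonempty`, O-pol by `exists_polarisation`, O-hyp by `hStd_hyperbolic`). Consequently no door theorem
of v4 ∕ v5 ∕ v6 quantifies over an empty type on the anchor side; what they cost is the DESIGN side (C0) and the OBJECT side
(C5–C7 + a named law) only. The kit is obtained by choice (opaque frame, `η = f₀^*g_M`, `t = 1`); for a concrete check use
`AnchorKit.ofFramePol` with the cell's own frame. -/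
theorem anchorKit_nonempty (hE : E₀.dim = 1) (hψ : ψ₀ ≫ ψ₀ = -(1 • 𝟙 E₀)) : Nonempty (AnchorKit E₀ ψ₀) := by
  obtain ⟨F⟩ := weilFrame_nonempty hE hψ
  obtain ⟨η, hη, hη0, pol, -⟩ := exists_polarisation hE hψ
  exact ⟨AnchorKit.ofFramePol hE hψ hη hη0 F pol⟩

/-- **PAD4-TOWER COMPATIBILITY WITH THE STUB'S BINDERS — every conjunct of `stub_rung_pad4_seedAt` EXCEPT `HasBlochSeedAt`
holds on every CM anchor, with the checker's own polarisation `h_K = symH = 2t·h_std` and a frame class `w = wOf 1`**: an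
embedding `e`, a rational `a ≠ 0`, hyperbolic Weil type of `symH (pad4Action E₀ ψ₀) e a`, and a rational non-zero class `w` of
the Weil plane. HONEST FLAG: this isolates the stub's ENTIRE open content in its last conjunct `HasBlochSeedAt 4 S⁴ h_K w` (the
seed); it is NOT a rung and proves nothing toward the crux — the analogous statement with the tree's weighted Segre class was
already available (`Anchor`'s use of `aimedSplitProduct_cmSquare_of_pos`); new here is only that the SAME holds for the kit's
equal-weight class, the one the C0–C8 dictionary is written in. -/
theorem stub_conjuncts_without_seed (hE : E₀.dim = 1) (hψ : ψ₀ ≫ ψ₀ = -(1 • 𝟙 E₀)) :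
    ∃ (e : ProjectiveEmbedding (pad4Anchor E₀).X) (a : complexBetti (projectiveSpace e.n ℂ) 2)
      (w : complexBetti (pad4Anchor E₀).X (2 * 4)),
      IsRationalClass a ∧ a ≠ 0 ∧ IsHyperbolicWeilType (pad4Anchor E₀) (pad4Action E₀ ψ₀) 4 (symH (pad4Action E₀ ψ₀) e a) ∧
        w ∈ weilClassesOf (pad4Anchor E₀) (pad4Action E₀ ψ₀) 4 1 ∧ IsRationalClass w ∧ w ≠ 0 := by
  obtain ⟨K⟩ := anchorKit_nonempty hE hψ
  exact ⟨K.pol.e, K.pol.a, K.F.wOf 1, K.pol.a_rational, K.pol.a_ne_zero, K.hyperbolic_symH hE hψ, K.F.wOf_mem 1,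
    K.F.wOf_rational 1, K.F.wOf_ne_zero one_ne_zero⟩

/-- **the crux through the lci checker, ANCHOR SIDE PAID**: `BlochSeedDiscOne` follows from — for every CM anchor and SOME kit
of it (kits exist, `anchorKit_nonempty`) — a design, a seed `i : Z ↪ S⁴` and a rational `q` passing v4's `Design.SeedCheck`.
Restated from v4's `blochSeedDiscOne_of_seedChecks` with the kit quantifier made explicit as `∀ K` ⇒ `∃ K` is NOT claimed: the
check is kit-RELATIVE (its (σ)-clause names `K.F.wOf μ` and `K.pol`), so the hypothesis keeps `∃ K`. Hypothesis-carrying;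
concludes the crux BY NAME; nothing toward it is proved here. -/
theorem blochSeedDiscOne_of_seedChecks'
    (h : ∀ (E₀ : AbelianVariety ℂ) (ψ₀ : E₀ ⟶ E₀), E₀.dim = 1 → ψ₀ ≫ ψ₀ = -(1 • 𝟙 E₀) →
      Nonempty (AnchorKit E₀ ψ₀) →
      ∃ (D : Design) (K : AnchorKit E₀ ψ₀) (Z : Scheme.{0}) (i : Z ⟶ (pad4Anchor E₀).X.left) (q : ℚ), D.SeedCheck K i q) :
    Summit.HodgeConjecture.HodgeConjecture.Theses.EightfoldBlochSeeds.BlochSeedDiscOne :=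
  blochSeedDiscOne_of_seedChecks fun E₀ ψ₀ hE hψ => h E₀ ψ₀ hE hψ (anchorKit_nonempty hE hψ)

end KitExists

/-! ## §9.1e THE LCI DOOR WITH THE WHOLE ANCHOR SIDE PAID: O-pol for EVERY rational generator; a frame-free, kit-free door -/

section FreeDoor

variable {E₀ : AbelianVariety ℂ} {ψ₀ : E₀ ⟶ E₀}

/-- `(c • x)ⁱ = cⁱ • xⁱ` (private copy of the tree's `cupPowTwo_smul`, as in v4 ∕ v5, to stay import-independent).
[cite: HatcherAT2002, §3.2] -/
private theorem cupPowTwo_smul_aux₉ {Y : Type} [TopologicalSpace Y] (c : ℂ) (x : singularCohomology ℂ ℂ Y 2)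
    (i : ℕ) : cupPowTwo (c • x) i = c ^ i • cupPowTwo x i := by
  induction i with
  | zero => rw [cupPowTwo_zero, cupPowTwo_zero, pow_zero, one_smul]
  | succ i ih =>
    rw [cupPowTwo_succ, cupPowTwo_succ, ih]
    simp only [map_smul, LinearMap.smul_apply, smul_smul, pow_succ, mul_comm]

/-- `h_S` is linear in `η`. -/
theorem hSurf_smul (c : ℂ) (η : complexBetti E₀.X 2) : hSurf E₀ (c • η) = c • hSurf E₀ η := by
  simp only [hSurf, map_smul, smul_add]

theorem hPad2_smul (c : ℂ) (η : complexBetti E₀.X 2) : hPad2 E₀ (c • η) = c • hPad2 E₀ η := by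
  simp only [hPad2, hSurf_smul, map_smul, smul_add]

theorem hPad3_smul (c : ℂ) (η : complexBetti E₀.X 2) : hPad3 E₀ (c • η) = c • hPad3 E₀ η := by
  simp only [hPad3, hPad2_smul, hSurf_smul, map_smul, smul_add]

/-- `h_std` is linear in `η`. -/
theorem hStd_smul (c : ℂ) (η : complexBetti E₀.X 2) : hStd E₀ (c • η) = c • hStd E₀ η := by
  simp only [hStd, hPad3_smul, hSurf_smul, map_smul, smul_add]

/-- **O-pol FOR EVERY RATIONAL GENERATOR.** For every CM datum and EVERY rational `η ≠ 0` of `H²(E₀(ℂ); ℂ)` (in particular the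
cell's own generator `η₀`) there is a polarisation datum `Polarisation E₀ η`: `H²(E₀(ℂ); ℂ)` is a line spanned by any non-zero
rational class (`SegreHyperplaneClass.exists_eq_ratCast_smul_of_curve`), so `exists_polarisation`'s `η' = s·η` with a rational
`s ≠ 0`, and `e^*a = t·h_std(η') = ts·h_std(η)`; if `s < 0` replace `a` by `−a`. So the checker may be run against the cell's `η₀`
and CONSUMED by the doors with no loss. [cite: Hartshorne1977, II Ex. 5.11 and Ex. 5.12] [cite: HatcherAT2002, Thm. 3.19] -/
theorem polarisation_nonempty (hE : E₀.dim = 1) (hψ : ψ₀ ≫ ψ₀ = -(1 • 𝟙 E₀)) {η : complexBetti E₀.X 2}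
    (hη : IsRationalClass η) (hη0 : η ≠ 0) : Nonempty (Polarisation E₀ η) := by
  obtain ⟨η', hη'r, hη'0, pol, -⟩ := exists_polarisation hE hψ
  obtain ⟨s, hs⟩ := SegreHyperplaneClass.exists_eq_ratCast_smul_of_curve E₀ hE hη hη0 hη'r
  have hs0 : s ≠ 0 := by
    rintro rfl
    exact hη'0 (by rw [hs, Rat.cast_zero, zero_smul])
  have hη's : hStd E₀ η' = ((s : ℚ) : ℂ) • hStd E₀ η := by rw [hs, hStd_smul]
  have hpull : complexBetti.map pol.e.ι 2 pol.a = (((pol.t * s : ℚ)) : ℂ) • hStd E₀ η := by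
    rw [pol.pullback_eq, hη's, smul_smul, ← Rat.cast_mul]
  rcases lt_or_gt_of_ne hs0 with hneg | hpos
  · have hneg_rat : IsRationalClass (-pol.a) := by
      have h := pol.a_rational.smul (-1 : ℚ)
      rwa [Rat.cast_neg, Rat.cast_one, neg_one_smul] at h
    refine ⟨⟨pol.e, -pol.a, -(pol.t * s), hneg_rat, neg_ne_zero.2 pol.a_ne_zero, ?_, ?_⟩⟩
    · exact neg_pos.2 (mul_neg_of_pos_of_neg pol.t_pos hneg)
    · rw [map_neg, hpull, Rat.cast_neg, neg_smul]
  · exact ⟨⟨pol.e, pol.a, pol.t * s, pol.a_rational, pol.a_ne_zero, mul_pos pol.t_pos hpos, hpull⟩⟩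

/-- **THE ANCHOR KIT FOR EVERY RATIONAL GENERATOR AND EVERY FRAME**: `η` rational `≠ 0` and a Weil frame `F` (e.g. the cell's
normalised one, once built) give a kit with `K.η = η`, `K.F = F`. -/
theorem anchorKit_nonempty_of_frame (hE : E₀.dim = 1) (hψ : ψ₀ ≫ ψ₀ = -(1 • 𝟙 E₀)) {η : complexBetti E₀.X 2}
    (hη : IsRationalClass η) (hη0 : η ≠ 0) (F : WeilFrame E₀ ψ₀) : ∃ K : AnchorKit E₀ ψ₀, K.η = η ∧ K.F = F := by
  obtain ⟨pol⟩ := polarisation_nonempty hE hψ hη hη0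
  exact ⟨AnchorKit.ofFramePol hE hψ hη hη0 F pol, rfl, rfl⟩

/-- **THE LCI DOOR WITH THE WHOLE ANCHOR SIDE PAID (frame-free, kit-free, polarisation-free).** The crux `BlochSeedDiscOne`
follows from: on every CM anchor `(E₀, ψ₀)`, for SOME rational `η ≠ 0` of `H²(E₀(ℂ); ℂ)` (e.g. the cell's generator), an LCI SEED —
a closed regular immersion `i : Z ↪ S⁴` of codimension `4` of an integral scheme whose points have codimension `≥ 4` (C5, C6),
Bloch-semiregular in the `8`-fold `S⁴` (C7), whose supported classes contain `c·h_std(η)⁴ + w` for a rational `c` and a RATIONAL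
NON-ZERO WEIL CLASS `w` of `(S⁴, ψ)` ((σ), object half; ANY `w` — no frame, no `μ`, no kit). The stub's embedding `e`, class `a`,
scale `t`, hyperbolicity of `h_K = symH = 2t·h_std(η)` and the coefficient `q = c ∕ (2t)⁴` are supplied HERE by v6's theorems
(`polarisation_nonempty`, `isHyperbolicWeilType_symH_of_pullback_eq`, `symH_eq_smul_hStd`). Hypothesis-carrying; concludes the
crux BY NAME via `Anchor.blochSeedDiscOne_of_forall_pad4_seedAt`; what it leaves is EXACTLY the seed (object side + (σ)). Nothing
toward the crux is proved here. -/
theorem blochSeedDiscOne_of_lciSeeds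
    (h : ∀ (E₀ : AbelianVariety ℂ) (ψ₀ : E₀ ⟶ E₀), E₀.dim = 1 → ψ₀ ≫ ψ₀ = -(1 • 𝟙 E₀) →
      ∃ (η : complexBetti E₀.X 2) (Z : Scheme.{0}) (i : Z ⟶ (pad4Anchor E₀).X.left) (c : ℚ)
        (w : complexBetti (pad4Anchor E₀).X (2 * 4)),
        IsRationalClass η ∧ η ≠ 0 ∧ w ∈ weilClassesOf (pad4Anchor E₀) (pad4Action E₀ ψ₀) 4 1 ∧ IsRationalClass w ∧ w ≠ 0 ∧
        IsClosedImmersion i ∧ IsRegularImmersionOfCodim i 4 ∧ AlgebraicGeometry.IsIntegral Z ∧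
        (∀ z ∈ Set.range i.base, ((4 : ℕ) : ℕ∞) ≤ Order.coheight z) ∧ IsBlochSemiregular i (2 * 4) 4 ∧
        ((c : ℚ) : ℂ) • cupPowTwo (hStd E₀ η) 4 + w ∈ classesSupportedOn (pad4Anchor E₀).X (Set.range i.base) (2 * 4)) :
    Summit.HodgeConjecture.HodgeConjecture.Theses.EightfoldBlochSeeds.BlochSeedDiscOne :=
  blochSeedDiscOne_of_forall_pad4_seedAt fun E₀ ψ₀ hE hψ => by
    obtain ⟨η, Z, i, c, w, hη, hη0, hwW, hwr, hw0, hci, hreg, hint, hcoh, hsr, hsupp⟩ := h E₀ ψ₀ hE hψ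
    obtain ⟨pol⟩ := polarisation_nonempty hE hψ hη hη0
    have hK : symH (pad4Action E₀ ψ₀) pol.e pol.a = (((2 * pol.t : ℚ)) : ℂ) • hStd E₀ η :=
      symH_eq_smul_hStd hE hψ pol.e pol.a pol.t pol.pullback_eq
    have h2t : (((2 * pol.t : ℚ)) : ℂ) ≠ 0 := by exact_mod_cast mul_ne_zero two_ne_zero pol.t_pos.ne'
    have hq : (((c / (2 * pol.t) ^ 4 : ℚ)) : ℂ) • cupPowTwo (symH (pad4Action E₀ ψ₀) pol.e pol.a) 4 =
        ((c : ℚ) : ℂ) • cupPowTwo (hStd E₀ η) 4 := by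
      rw [hK, cupPowTwo_smul_aux₉, smul_smul, Rat.cast_div, Rat.cast_pow, div_mul_cancel₀ _ (pow_ne_zero _ h2t)]
    refine ⟨pol.e, pol.a, w, pol.a_rational, pol.a_ne_zero,
      isHyperbolicWeilType_symH_of_pullback_eq hE hψ hη pol.e pol.a pol.t_pos.ne' pol.pullback_eq, hwW, hwr, hw0,
      Z, i, c / (2 * pol.t) ^ 4, hci, hreg, hint, hcoh, hsr, ?_⟩
    rw [hq]
    exact hsupp

end FreeDoor

/-! ## §9.1f THE SHEAF DOOR WITH THE WHOLE ANCHOR SIDE PAID (frame-free input for H2's `HasHyperbolicBFSheafSeedOn C 4 1 I`) -/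

section FreeSheafDoor

variable {E₀ : AbelianVariety ℂ} {ψ₀ : E₀ ⟶ E₀}

/-- **THE SHEAF DOOR WITH THE WHOLE ANCHOR SIDE PAID.** On a CM anchor, for ANY rational `η ≠ 0` (e.g. the cell's generator): a
finite locally free, `I`-semiregular sheaf `𝓔` on `S⁴` (`4 ∈ I`) which is (A1)-CLEAN AT THE SEED against `h_std(η)` with a FREE Weil
part — `ch_p(𝓔) = c_p·h_std^p` for `p ∈ I ∖ {4}` and `ch₄(𝓔) = q·h_std⁴ + w` with `w` ANY rational non-zero Weil class of `(S⁴, ψ)` —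
gives the tree's `HasHyperbolicBFSheafSeedOn C 4 1 I` (the input of `SheafSeedOnAnchor`'s H2 door). v4's `hasHyperbolicBFSheafSeedOn_of_
sheafSeedCheck` needed a kit and the design's `wOf μ`; here the embedding, `a`, `t`, hyperbolicity of `h_K = 2t·h_std` are supplied by
§9.1–9.1e and the coefficients are rescaled by `(2t)^{-p}` (`ℚ[h_K] = ℚ[h_std]`). Pure repackaging + v6's anchor theorems; realises
nothing. [cite: BuchweitzFlenner2003, §5 (I-semiregular)] -/
theorem hasHyperbolicBFSheafSeedOn_of_cleanSheaf (hE : E₀.dim = 1) (hψ : ψ₀ ≫ ψ₀ = -(1 • 𝟙 E₀)) {C : ChernCharacterBetti}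
    {I : Finset ℕ} (h4 : 4 ∈ I) {η : complexBetti E₀.X 2} (hη : IsRationalClass η) (hη0 : η ≠ 0)
    {𝓔 : (pad4Anchor E₀).X.left.Modules} (h𝓔 : IsFiniteLocallyFree 𝓔) (hsr : IsISemiregular h𝓔 {q' | q' + 1 ∈ I})
    {w : complexBetti (pad4Anchor E₀).X (2 * 4)} (hwW : w ∈ weilClassesOf (pad4Anchor E₀) (pad4Action E₀ ψ₀) 4 1)
    (hwr : IsRationalClass w) (hw0 : w ≠ 0) {c : ℕ → ℚ} {q : ℚ}
    (hc : ∀ p ∈ I, p ≠ 4 → C.ch (pad4Anchor E₀).X 𝓔 p = ((c p : ℚ) : ℂ) • cupPowTwo (hStd E₀ η) p)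
    (hq : C.ch (pad4Anchor E₀).X 𝓔 4 = ((q : ℚ) : ℂ) • cupPowTwo (hStd E₀ η) 4 + w) :
    HasHyperbolicBFSheafSeedOn C 4 1 I := by
  obtain ⟨pol⟩ := polarisation_nonempty hE hψ hη hη0
  have hK : symH (pad4Action E₀ ψ₀) pol.e pol.a = (((2 * pol.t : ℚ)) : ℂ) • hStd E₀ η :=
    symH_eq_smul_hStd hE hψ pol.e pol.a pol.t pol.pullback_eq
  have h2t : (((2 * pol.t : ℚ)) : ℂ) ≠ 0 := by exact_mod_cast mul_ne_zero two_ne_zero pol.t_pos.ne'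
  have key : ∀ (p : ℕ) (x : ℚ), ((x : ℚ) : ℂ) • cupPowTwo (hStd E₀ η) p =
      (((x / (2 * pol.t) ^ p : ℚ)) : ℂ) • cupPowTwo (symH (pad4Action E₀ ψ₀) pol.e pol.a) p := by
    intro p x
    rw [hK, cupPowTwo_smul_aux₉, smul_smul, Rat.cast_div, Rat.cast_pow, div_mul_cancel₀ _ (pow_ne_zero _ h2t)]
  have hq' : C.ch (pad4Anchor E₀).X 𝓔 4 =
      (((q / (2 * pol.t) ^ 4 : ℚ)) : ℂ) • cupPowTwo (symH (pad4Action E₀ ψ₀) pol.e pol.a) 4 + w := by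
    rw [hq, key 4 q]
  have hc' : ∀ p ∈ I, p ≠ 4 → C.ch (pad4Anchor E₀).X 𝓔 p =
      ((((fun p => c p / (2 * pol.t) ^ p) p : ℚ)) : ℂ) • cupPowTwo (symH (pad4Action E₀ ψ₀) pol.e pol.a) p :=
    fun p hpI hp4 => by rw [hc p hpI hp4, key p (c p)]
  have hseed : HasBFSheafSeedOn C 4 I (pad4Anchor E₀) (symH (pad4Action E₀ ψ₀) pol.e pol.a) w :=
    ⟨𝓔, h𝓔, q / (2 * pol.t) ^ 4, fun p => c p / (2 * pol.t) ^ p, h4, hsr, hq', hc'⟩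
  exact ⟨pad4Anchor E₀, pad4Action E₀ ψ₀, pol.e, pol.a, w, pad4Anchor_dim hE, pad4Action_comp_self hψ, pol.a_rational,
    pol.a_ne_zero, isHyperbolicWeilType_symH_of_pullback_eq hE hψ hη pol.e pol.a pol.t_pos.ne' pol.pullback_eq, hwW, hwr, hw0,
    hseed⟩

end FreeSheafDoor

/-! ## §9.2 Law hygiene: the top-Chern-class localisation law ON ONE CARRIER, and the zero-scheme door re-derived from it -/

section LocalLaw

variable {C : ChernCharacterBetti}

/-- **THE TOP-CHERN-CLASS LOCALISATION LAW ON THE CARRIER `X`** — v4's `TopChernFourLocalisation C` restricted to ONE complex scheme `X`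
(a `Prop`, NEITHER PROVED NOR ASSERTED; consumed as a hypothesis): for every vector bundle `𝓕` of constant rank `4` on `X` and every section
`s` with zero scheme `i : Z ↪ X`, `c₄(𝓕)` is supported on `Z`. The doors instantiate the law at `X = S⁴` only, so this is all they need;
the global law implies it (`TopChernFourLocalisation.on`). [cite: Fulton1998, Example 14.1.1, Prop. 14.1 (b), Thm. 3.2 and §19.1] -/
def TopChernFourLocalisationOn (C : ChernCharacterBetti) (X : Motives.SchemeOver ℂ) : Prop :=
  ∀ (𝓕 : X.left.Modules), HasRank 𝓕 4 →
    ∀ (s : Modules.unitModule X.left ⟶ 𝓕) ⦃Z : Scheme.{0}⦄ (i : Z ⟶ X.left), IsZeroSchemeOf s i →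
      chernFour C X 𝓕 ∈ classesSupportedOn X (Set.range i.base) (2 * 4)

theorem TopChernFourLocalisation.on (h : TopChernFourLocalisation C) (X : Motives.SchemeOver ℂ) :
    TopChernFourLocalisationOn C X :=
  h X

theorem topChernFourLocalisation_iff_forall_on :
    TopChernFourLocalisation C ↔ ∀ X : Motives.SchemeOver ℂ, TopChernFourLocalisationOn C X :=
  Iff.rfl

variable {E₀ : AbelianVariety ℂ} {ψ₀ : E₀ ⟶ E₀}

/-- **(σ) object half from a zero scheme under the ANCHOR-LOCAL law** (v4's `supported_of_zeroScheme` with `TopChernFourLocalisationOn C S⁴`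
in place of the global law; same explicit `q = −q'∕6`). -/
theorem supported_of_zeroScheme_on {I : Finset ℕ} {F : WeilFrame E₀ ψ₀} {h : complexBetti (pad4Anchor E₀).X 2}
    {𝓕 : (pad4Anchor E₀).X.left.Modules} {μ : GaussianInt} (hloc : TopChernFourLocalisationOn C (pad4Anchor E₀).X)
    (hrk : HasRank 𝓕 4) (hcl : CleanAtSeed C I F h 𝓕 μ) (h1 : 1 ∈ I) (h2 : 2 ∈ I) (h3 : 3 ∈ I)
    (s : Modules.unitModule (pad4Anchor E₀).X.left ⟶ 𝓕) {Z : Scheme.{0}} {i : Z ⟶ (pad4Anchor E₀).X.left}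
    (hZ : IsZeroSchemeOf s i) :
    ∃ q : ℚ, ((q : ℚ) : ℂ) • cupPowTwo h 4 + F.wOf μ ∈ classesSupportedOn (pad4Anchor E₀).X (Set.range i.base) (2 * 4) := by
  obtain ⟨q', hq'⟩ := chernFour_eq_of_cleanAtSeed hcl h1 h2 h3
  have hmem := hloc 𝓕 hrk s i hZ
  rw [hq', WeilFrame.wOf_intCast_mul] at hmem
  have hmem' := Submodule.smul_mem _ ((((-1 : ℚ) / 6 : ℚ)) : ℂ) hmem
  refine ⟨-1 / 6 * q', ?_⟩
  convert hmem' using 1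
  rw [smul_add, smul_smul, smul_smul, ← Rat.cast_mul, ← Rat.cast_mul]
  norm_num

/-- … against the kit's `h_K = symH = 2t·h_std`. -/
theorem supported_symH_of_zeroScheme_on (hE : E₀.dim = 1) (hψ : ψ₀ ≫ ψ₀ = -(1 • 𝟙 E₀)) (K : AnchorKit E₀ ψ₀) {I : Finset ℕ}
    {𝓕 : (pad4Anchor E₀).X.left.Modules} {μ : GaussianInt} (hloc : TopChernFourLocalisationOn C (pad4Anchor E₀).X)
    (hrk : HasRank 𝓕 4) (hcl : CleanAtSeed C I K.F (hStd E₀ K.η) 𝓕 μ) (h1 : 1 ∈ I) (h2 : 2 ∈ I) (h3 : 3 ∈ I)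
    (s : Modules.unitModule (pad4Anchor E₀).X.left ⟶ 𝓕) {Z : Scheme.{0}} {i : Z ⟶ (pad4Anchor E₀).X.left}
    (hZ : IsZeroSchemeOf s i) :
    ∃ q : ℚ, ((q : ℚ) : ℂ) • cupPowTwo (symH (pad4Action E₀ ψ₀) K.pol.e K.pol.a) 4 + K.F.wOf μ ∈
      classesSupportedOn (pad4Anchor E₀).X (Set.range i.base) (2 * 4) :=
  supported_of_zeroScheme_on hloc hrk (cleanAtSeed_symH_of_hStd hE hψ K hcl) h1 h2 h3 s hZ

/-- **THE LCI DOOR END-TO-END FROM A ZERO SCHEME UNDER THE ANCHOR-LOCAL LAW** (v4's `Design.seedCheck_of_zeroScheme`, law weakened to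
`TopChernFourLocalisationOn C S⁴`; C0, rank `4`, (A1@Z) with the design's `μ`, the zero scheme and its C5–C7 remain hypotheses). -/
theorem Design.seedCheck_of_zeroScheme_on (hE : E₀.dim = 1) (hψ : ψ₀ ≫ ψ₀ = -(1 • 𝟙 E₀)) {D : Design} (hC0 : D.ClassData)
    (K : AnchorKit E₀ ψ₀) {I : Finset ℕ} {𝓕 : (pad4Anchor E₀).X.left.Modules} (hloc : TopChernFourLocalisationOn C (pad4Anchor E₀).X)
    (hrk : HasRank 𝓕 4) (hcl : CleanAtSeed C I K.F (hStd E₀ K.η) 𝓕 D.mu) (h1 : 1 ∈ I) (h2 : 2 ∈ I) (h3 : 3 ∈ I)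
    (s : Modules.unitModule (pad4Anchor E₀).X.left ⟶ 𝓕) {Z : Scheme.{0}} {i : Z ⟶ (pad4Anchor E₀).X.left}
    (hZ : IsZeroSchemeOf s i) (hreg : IsRegularImmersionOfCodim i 4) (hint : AlgebraicGeometry.IsIntegral Z)
    (hcoh : ∀ z ∈ Set.range i.base, ((4 : ℕ) : ℕ∞) ≤ Order.coheight z) (hsr : IsBlochSemiregular i (2 * 4) 4) :
    ∃ q : ℚ, D.SeedCheck K i q := by
  obtain ⟨q, hq⟩ := supported_symH_of_zeroScheme_on hE hψ K hloc hrk hcl h1 h2 h3 s hZ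
  exact ⟨q, hC0, hZ.isClosedImmersion, hreg, hint, hcoh, hsr, hq⟩

/-- … so such data on EVERY CM anchor, with the law ON THAT ANCHOR, give the crux `BlochSeedDiscOne` BY NAME (hypothesis-carrying; via
v4's `blochSeedDiscOne_of_seedChecks`). Nothing is asserted: no bundle, section or zero scheme is constructed in this file. -/
theorem blochSeedDiscOne_of_zeroSchemes_on
    (h : ∀ (E₀ : AbelianVariety ℂ) (ψ₀ : E₀ ⟶ E₀), E₀.dim = 1 → ψ₀ ≫ ψ₀ = -(1 • 𝟙 E₀) →
      TopChernFourLocalisationOn C (pad4Anchor E₀).X ∧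
      ∃ (D : Design) (_ : D.ClassData) (K : AnchorKit E₀ ψ₀) (I : Finset ℕ) (_ : 1 ∈ I) (_ : 2 ∈ I) (_ : 3 ∈ I)
        (𝓕 : (pad4Anchor E₀).X.left.Modules) (_ : HasRank 𝓕 4) (_ : CleanAtSeed C I K.F (hStd E₀ K.η) 𝓕 D.mu)
        (s : Modules.unitModule (pad4Anchor E₀).X.left ⟶ 𝓕) (Z : Scheme.{0}) (i : Z ⟶ (pad4Anchor E₀).X.left),
        IsZeroSchemeOf s i ∧ IsRegularImmersionOfCodim i 4 ∧ AlgebraicGeometry.IsIntegral Z ∧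
          (∀ z ∈ Set.range i.base, ((4 : ℕ) : ℕ∞) ≤ Order.coheight z) ∧ IsBlochSemiregular i (2 * 4) 4) :
    Summit.HodgeConjecture.HodgeConjecture.Theses.EightfoldBlochSeeds.BlochSeedDiscOne :=
  blochSeedDiscOne_of_seedChecks fun E₀ ψ₀ hE hψ => by
    obtain ⟨hloc, D, hC0, K, I, h1, h2, h3, 𝓕, hrk, hcl, s, Z, i, hZ, hreg, hint, hcoh, hsr⟩ := h E₀ ψ₀ hE hψ
    obtain ⟨q, hq⟩ := D.seedCheck_of_zeroScheme_on hE hψ hC0 K hloc hrk hcl h1 h2 h3 s hZ hreg hint hcoh hsr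
    exact ⟨D, K, Z, i, q, hq⟩

end LocalLaw

/-! ## §9.3 JSON: the two door budgets as checked constants -/

section Budgets

/-- **`h^{a,b}(E₀^g) = C(g,a)·C(g,b)`** — the Hodge numbers of a `g`-dimensional complex torus (Künneth on `H^{•,•}(E₀) = Λ^•(dz) ⊗ Λ^•(dz̄)`);
the identification with `dim_ℂ H^b(S⁴, Ωᵃ_{S⁴})` at `g = 8` is PENCIL (the tree's `hodgeCohomology` carries no dimension). A json-side number.
[cite: LangeBirkenhake1992, Thm. 1.4.1 and Cor. 1.4.?] -/
def hodgeNumberOfPower (g a b : ℕ) : ℕ := Nat.choose g a * Nat.choose g b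

/-- **THE SHEAF DOOR'S (σ)-BUDGET in the form-degree window `J`**: `Σ_{q ∈ J} h^{q, q+2}(E₀⁸)`, the dimension of the target
`⊕_{q ∈ J} H^{q+2}(S⁴, Ω^q)` of `σ = ⊕_q σ_q` on `Ext²(𝓔, 𝓔)`; injectivity of `σ` (v4's sheaf-door (σ), `IsISemiregular`) needs
`dim Ext²(𝓔, 𝓔) ≤ sheafDoorBudget J` (the cell's «door count», hsemireg-c4-1 g5 §12 — recorded there in pencil, here as arithmetic only). -/
def sheafDoorBudget (J : Finset ℕ) : ℕ := ∑ q ∈ J, hodgeNumberOfPower 8 q (q + 2)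

/-- the four summands of record: `h^{0,2} = 28`, `h^{1,3} = 448`, `h^{2,4} = 1960`, `h^{3,5} = 3136`. [`decide`] -/
theorem hodgeNumberOfPower_eight_window :
    hodgeNumberOfPower 8 0 2 = 28 ∧ hodgeNumberOfPower 8 1 3 = 448 ∧ hodgeNumberOfPower 8 2 4 = 1960 ∧
      hodgeNumberOfPower 8 3 5 = 3136 := by
  decide

/-- **the door count of record: `Σ_{q ≤ 3} h^{q,q+2}(E₀⁸) = 5572`.** [`decide`] -/
theorem sheafDoorBudget_window : sheafDoorBudget {0, 1, 2, 3} = 5572 := by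
  decide

/-- **THE LCI DOOR'S BUDGET `h^{3,5}(E₀⁸) = 3136`**: the dimension of the target `H⁵(S⁴, Ω³)` of Bloch's semiregularity map
`π : H¹(Z, 𝒩_{Z∕S⁴}) → H⁵(S⁴, Ω³)` for a codimension-`4` seed (`p = 4`: `H^{p+1}(Ω^{p−1})`); C7 (`π` injective, v5's
`isBlochSemiregular_eight_four_iff` in Serre-dual form) needs `h¹(𝒩_{Z∕S⁴}) ≤ 3136`. [cite: Bloch1972Semiregularity, §1 and Thm. 7.3] -/
def lciDoorBudget : ℕ := hodgeNumberOfPower 8 3 5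

theorem lciDoorBudget_eq : lciDoorBudget = 3136 := by
  decide

/-- the lci budget is the top summand of the sheaf budget's window. -/
theorem lciDoorBudget_le_sheafDoorBudget : lciDoorBudget ≤ sheafDoorBudget {0, 1, 2, 3} := by
  decide

end Budgets

end VSix

/-!
## Audit (v6.2): nothing is decided here

`hSurf_hyperbolic` … `hStd_hyperbolic`, `exists_polarisation`, `polarisation_nonempty`, `weilFrame_nonempty`, `anchorKit_nonempty(_of_frame)`,
`stub_conjuncts_without_seed` are unconditional theorems ABOUT THE ANCHOR (van Geemen 4.9, 5.2, 5.3 ∕ 5.4 and Hartshorne II Ex. 5.11–5.12 through the tree's rational models,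
rational-plane theorem and Segre toolbox) — they discharge the kit obligations O-hyp, O-pol, O-W (existence) and nothing else: the frame of
`anchorKit_nonempty` is opaque (O-W♮, the normalised frame of the json dictionary, is untouched); every door theorem (§9.2, v4 §4 ∕ §7.3,
v5 §8.5) still takes the design's C0, the realised object, its C5–C7 and a named localisation law as hypotheses, and the two anchor-paid
doors `blochSeedDiscOne_of_lciSeeds` (§9.1e) ∕ `hasHyperbolicBFSheafSeedOn_of_cleanSheaf` (§9.1f) take the SEED ITSELF (object, C5–C7, its
supported ∕ Chern class with a non-zero rational Weil part) as hypothesis — they only remove the anchor-side conjuncts. No instance of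
`Design.SeedCheck`, `SeedCertificate`, `HasBlochSeedAt` or `BlochSeedDiscOne` is produced; `stub_conjuncts_without_seed` is the stub
WITHOUT its seed conjunct and is not a rung. Nothing is proved toward HC ∕ HC_CM ∕ HC_AV ∕ №4 ∕ 26512 ∕ 18881 ∕ H2.
-/

end Summit.HodgeConjecture.HodgeConjecture.Cruxes.BlochSeedDiscOne.SeedChecker

end
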